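import Literature.NumberTheory.EllipticCurves.EisensteinDedekindMeasureTwo
import HarnessLib

/-!
# Values of Stevens-smoothed measures at `2`: the evenness pairing `(μ̌ ⋆ μ)(a) ∈ 2ℤ₂` and
# mod-`8` rigidity of the `η = +1` tower under `Sm_5^5`

Topic `Literature/NumberTheory/EllipticCurves`; namespace `Literature.NumberTheory.EllipticCurves`.
Theorem-only sequel to `EisensteinDedekindMeasureTwo` / `PAdicMeasureConvolutionProofs`.

§1 **Evenness pairing.** At `p = 2`, for `n ≥ 2`, the involution `x ↦ −x` of `(ℤ/2ⁿ)^×` has no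
fixed point, so a sum over the units of an EVEN summand bounded by `B` has norm `≤ ‖2‖·B`
(`norm_sum_units_le_half_of_neg_invariant`); hence the convolution of two even set functions bounded
by `C`, `D` has VALUES of norm `≤ C·D/2` (`norm_unitsConv_le_half_of_even`), in particular
`‖klTwoConv n a‖ ≤ ½` (`norm_klTwoConv_le_half`: the smoothed Dedekind–Eisenstein measure
`Sm_5^5((χ₋₄E₁)ˇ ⋆ χ₋₄E₁)` takes values in `2ℤ₂`) and
`‖Sm_5^5 E_{T,κ}(a + 2ⁿℤ₂)‖ ≤ ½` for `2`-integral level coefficients `κ`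
(`norm_smoothedEisensteinDedekindTwo_le_half`) — the value-level companion of `¼L(klTwoConv) ∈ Λ`
(`exists_iwasawa_quarter_klTwoConv`). [Stevens1982, §5.4 Prop. 5.4.1: `Sm μ_E` is a measure;
Lang Ch. 4 §3: the measure `χE_{1,c}`.]

§2 **Mod-`8` rigidity under `Sm_5^5` on the `η = +1` tower.** Let `f` be a `ℤ₂`-valued set function on
the classes `a ≡ 1 (mod 4)` of the levels `2^{m+2}`, `m ≥ m₀`, with `f(1 + 2^{m+2}ℤ₂) = 0`, whose
Stevens smoothing `Sm_5^5 f` is `≡ 0 (mod 8)` valuewise and which satisfies the distribution relation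
`mod 8` up to a level constant.  Then `f ≡ 0 (mod 8)` valuewise (`norm_le_eighth_of_stevensSmoothing`).
Mechanism: on the cyclic group `Γ_m = ⟨5⟩ ≅ ℤ/2^m` of `η = +1` classes, `Sm ≡ 0` forces constant second
differences `f(5^{s+2}) − 2f(5^{s+1}) + f(5^s) ≡ 0`, so `f(5^s) ≡ s·δ_m`; the tower relation gives
`δ_m ≡ 2δ_{m+1}`, whence `δ_m ≡ 8δ_{m+3} ≡ 0`.  (In `ℤ/8[Γ_m]` the smoothing operator
`(1 − 5[5]_*)(1 − 5[5]^*)` is NOT injective — `1 − 5γ` is a zero divisor — so this un-smoothing needs the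
tower; it is the value-level counterpart of dividing by the smoothing factor `16 + 16T − 5T² ≡ T²`.)
Helpers: the classes `≡ 1 (mod 4)` of level `2^{m+2}` are exactly the `5^s` (`exists_pow_five_eq_of_val_mod_four`,
via `exists_classMap_eq_of_isUnit`), the fibre of `ℤ/2^{n+1} → ℤ/2ⁿ` (`sum_filter_castHom_eq_add`), and the
two lifts of `5^s` (`sum_filter_castHom_pow_five`).

Requested for line `star` of crux `stmt-BirchSwinnertonDyer-20341` (the «`8 ∣ v` on `C`» / «`ν₈` is
`2`-integral» input of the Eisenstein cusp measure: apply §2 to `g′·eisNormMeasure` with §1 for the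
smoothing hypothesis).  Everything is proved; no named facts.

## References

* G. Stevens, *Arithmetic on Modular Curves*, Progress in Math. 20, Birkhäuser 1982 — §5.2 (PDF pp. 68–69:
  `Sm_r`), §5.4 (PDF p. 73: `Sm_{r₁}^{r₂}`, Prop. 5.4.1). Held text `book:stevensnd-arithmetic-modular-curves`.
  [Stevens1982]
* S. Lang, *Cyclotomic Fields I and II*, GTM 121, Springer 1990 — Ch. 4 §1 (PDF pp. 77–78), §3 (PDF p. 84),
  Ch. 12 §1 (PDF p. 187). [LangCyclotomic1990]
* L. Washington, *Introduction to Cyclotomic Fields*, GTM 83 — §7.2 (`ℤ₂^× = {±1} × 5^{ℤ₂}`). [Washington1997]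
-/

noncomputable section

open scoped Classical

open Filter Topology

namespace Literature.NumberTheory.EllipticCurves

/-! ## §0 Small `2`-adic norm facts -/

section NormFacts

/-- `‖2^k‖₂ = 2^{-k}`. [cite: LangCyclotomic1990, Ch. 4 §1 (PDF pp. 77–78, the p-adic absolute value)] -/
private theorem norm_two_pow (k : ℕ) : ‖((2 : ℚ_[2]) ^ k)‖ = ((2 : ℝ) ^ k)⁻¹ := by
  rw [norm_pow, show (2 : ℚ_[2]) = ((2 : ℕ) : ℚ_[2]) by norm_num, Padic.norm_p]
  simp [inv_pow]

/-- `‖2‖₂ = ½`. [folklore] -/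
private theorem norm_two' : ‖(2 : ℚ_[2])‖ = 2⁻¹ := by simpa using norm_two_pow 1

/-- `‖8‖₂ = ⅛`. [folklore] -/
private theorem norm_eight' : ‖(8 : ℚ_[2])‖ = 8⁻¹ := by
  have h := norm_two_pow 3; norm_num at h ⊢; exact h

/-- `‖16‖₂ = 1/16`. [folklore] -/
private theorem norm_sixteen' : ‖(16 : ℚ_[2])‖ = 16⁻¹ := by
  have h := norm_two_pow 4; norm_num at h ⊢; exact h

/-- `‖5‖₂ = 1`. [cite: LangCyclotomic1990, Ch. 4 §1 (PDF pp. 77–78)] -/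
private theorem norm_five' : ‖(5 : ℚ_[2])‖ = 1 := by
  have h : ‖((5 : ℕ) : ℚ_[2])‖ = 1 := Padic.norm_natCast_eq_one_iff.mpr (by norm_num)
  simpa using h

/-- `‖s‖₂ ≤ 1` for a natural number `s`. [cite: LangCyclotomic1990, Ch. 4 §1 (PDF pp. 77–78)] -/
private theorem norm_natCast_le_one' (s : ℕ) : ‖(s : ℚ_[2])‖ ≤ 1 := by
  have h := Padic.norm_int_le_one (p := 2) (s : ℤ)
  push_cast at h
  exact h

/-- Ultrametric inequality for differences. [cite: LangCyclotomic1990, Ch. 4 §1 (PDF pp. 77–78)] -/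
private theorem norm_sub_le_max' (q r : ℚ_[2]) : ‖q - r‖ ≤ max ‖q‖ ‖r‖ := by
  rw [sub_eq_add_neg, ← norm_neg r]
  exact Padic.nonarchimedean q (-r)

/-- Ultrametric inequality for sums. [cite: LangCyclotomic1990, Ch. 4 §1 (PDF pp. 77–78)] -/
private theorem norm_add_le_max' (q r : ℚ_[2]) : ‖q + r‖ ≤ max ‖q‖ ‖r‖ :=
  Padic.nonarchimedean q r

end NormFacts

/-! ## §1 The evenness pairing on `(ℤ/2ⁿ)^×` -/

section Pairing

/-- For `n ≥ 1` a unit of `ℤ/2ⁿ` has odd `val`. [cite: Washington1997, §7.2 (the units of ℤ/2ⁿ)] -/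
theorem odd_val_of_isUnit_two_pow {n : ℕ} (hn : 1 ≤ n) {x : ZMod (2 ^ n)} (hx : IsUnit x) :
    Odd x.val := by
  haveI : NeZero (2 ^ n) := ⟨pow_ne_zero _ two_ne_zero⟩
  have hx' : IsUnit ((x.val : ℕ) : ZMod (2 ^ n)) := by rwa [ZMod.natCast_zmod_val]
  have hcop : x.val.Coprime (2 ^ n) := (ZMod.isUnit_iff_coprime _ _).mp hx'
  have h2 : x.val.Coprime 2 := hcop.coprime_dvd_right (dvd_pow_self 2 (by omega))
  exact Nat.coprime_two_right.mp h2

/-- For `n ≥ 2` the involution `x ↦ −x` of `(ℤ/2ⁿ)^×` has no fixed point.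
[cite: Washington1997, §7.2 (ℤ₂^× = {±1} × (1 + 4ℤ₂))] -/
theorem neg_ne_self_of_isUnit_two_pow {n : ℕ} (hn : 2 ≤ n) (x : (ZMod (2 ^ n))ˣ) : -x ≠ x := by
  haveI : NeZero (2 ^ n) := ⟨pow_ne_zero _ two_ne_zero⟩
  intro h
  have hodd := odd_val_of_isUnit_two_pow (by omega) (Units.isUnit x)
  have h2 : (x : ZMod (2 ^ n)) + (x : ZMod (2 ^ n)) = 0 := by
    have h' : ((-x : (ZMod (2 ^ n))ˣ) : ZMod (2 ^ n)) = (x : ZMod (2 ^ n)) := by rw [h]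
    rw [Units.val_neg] at h'
    linear_combination -h'
  have hval : ((x : ZMod (2 ^ n)).val + (x : ZMod (2 ^ n)).val) % 2 ^ n = 0 := by
    rw [← ZMod.val_add, h2, ZMod.val_zero]
  obtain ⟨k, hk⟩ := Nat.dvd_of_mod_eq_zero hval
  obtain ⟨n', rfl⟩ : ∃ n', n = n' + 2 := ⟨n - 2, by omega⟩
  have hk' : (x : ZMod (2 ^ (n' + 2))).val + (x : ZMod (2 ^ (n' + 2))).val = 4 * (2 ^ n' * k) := by
    rw [hk]; ring
  obtain ⟨j, hj⟩ := hodd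
  omega

/-- **Evenness pairing**: for `n ≥ 2`, a sum over `(ℤ/2ⁿ)^×` of a summand invariant under `x ↦ −x` and
bounded by `B` has norm `≤ ‖2‖·B = B/2` (the orbits `{x, −x}` have two elements).
[cite: Washington1997, §7.2 (ℤ₂^× = {±1} × (1 + 4ℤ₂))] [cite: LangCyclotomic1990, Ch. 4 §1 (PDF pp. 77–78)] -/
theorem norm_sum_units_le_half_of_neg_invariant {n : ℕ} (hn : 2 ≤ n) (g : (ZMod (2 ^ n))ˣ → ℚ_[2])
    (hg : ∀ x, g (-x) = g x) {B : ℝ} (hB : ∀ x, ‖g x‖ ≤ B) :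
    ‖∑ x, g x‖ ≤ 2⁻¹ * B := by
  haveI : NeZero (2 ^ n) := ⟨pow_ne_zero _ two_ne_zero⟩
  haveI : Fact (1 < 2 ^ n) := ⟨Nat.one_lt_two_pow (by omega)⟩
  have hB0 : 0 ≤ B := (norm_nonneg _).trans (hB 1)
  obtain ⟨n', rfl⟩ : ∃ n', n = n' + 2 := ⟨n - 2, by omega⟩
  have hM : 2 ^ (n' + 2) = 2 * 2 ^ (n' + 1) := by ring
  have hM' : 2 ^ (n' + 1) = 2 * 2 ^ n' := by ring
  -- the half-system `H = {x : x.val < 2^{n-1}}`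
  set H : Finset (ZMod (2 ^ (n' + 2)))ˣ :=
    Finset.univ.filter (fun x ↦ (x : ZMod (2 ^ (n' + 2))).val < 2 ^ (n' + 1)) with hH
  have hne0 : ∀ x : (ZMod (2 ^ (n' + 2)))ˣ, (x : ZMod (2 ^ (n' + 2))) ≠ 0 :=
    fun x ↦ (Units.isUnit x).ne_zero
  have hnegval : ∀ x : (ZMod (2 ^ (n' + 2)))ˣ,
      ((-x : (ZMod (2 ^ (n' + 2)))ˣ) : ZMod (2 ^ (n' + 2))).val =
        2 ^ (n' + 2) - (x : ZMod (2 ^ (n' + 2))).val := by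
    intro x
    rw [Units.val_neg, ZMod.neg_val, if_neg (hne0 x)]
  have hoddv : ∀ x : (ZMod (2 ^ (n' + 2)))ˣ, Odd (x : ZMod (2 ^ (n' + 2))).val :=
    fun x ↦ odd_val_of_isUnit_two_pow (by omega) (Units.isUnit x)
  have hlt : ∀ x : (ZMod (2 ^ (n' + 2)))ˣ, (x : ZMod (2 ^ (n' + 2))).val < 2 ^ (n' + 2) :=
    fun x ↦ ZMod.val_lt _
  have hmemH : ∀ x : (ZMod (2 ^ (n' + 2)))ˣ, x ∈ H ↔ (x : ZMod (2 ^ (n' + 2))).val < 2 ^ (n' + 1) := by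
    intro x; simp [hH]
  -- `x ∉ H ↔ −x ∈ H`
  have hmem : ∀ x : (ZMod (2 ^ (n' + 2)))ˣ, x ∉ H ↔ -x ∈ H := by
    intro x
    rw [hmemH, hmemH, hnegval]
    have hx := hlt x
    obtain ⟨j, hj⟩ := hoddv x
    generalize (x : ZMod (2 ^ (n' + 2))).val = v at hx hj ⊢
    omega
  have hcompl : ∑ x ∈ Hᶜ, g x = ∑ x ∈ H, g x := by
    refine Finset.sum_nbij' (fun x ↦ -x) (fun x ↦ -x) ?_ ?_ ?_ ?_ ?_
    · intro x hx
      exact (hmem x).mp (Finset.mem_compl.mp hx)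
    · intro x hx
      rw [Finset.mem_compl, hmem, neg_neg]
      exact hx
    · intro x _; exact neg_neg x
    · intro x _; exact neg_neg x
    · intro x _; exact (hg x).symm
  calc ‖∑ x, g x‖ = ‖∑ x ∈ H, g x + ∑ x ∈ Hᶜ, g x‖ := by rw [Finset.sum_add_sum_compl]
    _ = ‖2 * ∑ x ∈ H, g x‖ := by rw [hcompl, two_mul]
    _ ≤ 2⁻¹ * B := by
        rw [norm_mul, norm_two']
        refine mul_le_mul_of_nonneg_left ?_ (by norm_num)
        exact IsUltrametricDist.norm_sum_le_of_forall_le_of_nonneg hB0 fun x _ ↦ hB x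

variable {μ ν : (n : ℕ) → ZMod (2 ^ n) → ℚ_[2]}

/-- **`‖(μ ⋆ ν)(a + 2ⁿℤ₂)‖ ≤ C·D/2` for EVEN `μ`, `ν` bounded by `C`, `D` and `n ≥ 2`**: the summand
`μ(x)ν(a x⁻¹)` of the convolution is invariant under `x ↦ −x`.
[cite: LangCyclotomic1990, Ch. 12 §1 (PDF p. 187, convolution of measures) and Ch. 4 §1 (PDF pp. 77–78)] -/
theorem norm_unitsConv_le_half_of_even {n : ℕ} (hn : 2 ≤ n)
    (hμ : ∀ (n : ℕ) (a : ZMod (2 ^ n)), μ n (-a) = μ n a)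
    (hν : ∀ (n : ℕ) (a : ZMod (2 ^ n)), ν n (-a) = ν n a)
    {C D : ℝ} (hC : ∀ (n : ℕ) (a : ZMod (2 ^ n)), ‖μ n a‖ ≤ C)
    (hD : ∀ (n : ℕ) (a : ZMod (2 ^ n)), ‖ν n a‖ ≤ D) (a : ZMod (2 ^ n)) :
    ‖unitsConv μ ν n a‖ ≤ 2⁻¹ * (C * D) := by
  have hC0 : 0 ≤ C := (norm_nonneg _).trans (hC 0 0)
  rw [unitsConv_apply]
  refine norm_sum_units_le_half_of_neg_invariant hn _ (fun x ↦ ?_) (fun x ↦ ?_)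
  · have hinv : ((-x)⁻¹ : (ZMod (2 ^ n))ˣ) = -x⁻¹ := by
      rw [inv_eq_iff_mul_eq_one, neg_mul_neg, mul_inv_cancel]
    rw [hinv, Units.val_neg, hμ, Units.val_neg, mul_neg, hν]
  · rw [norm_mul]
    exact mul_le_mul (hC _ _) (hD _ _) (norm_nonneg _) hC0

/-- **`‖klTwoConv(a + 2ⁿℤ₂)‖ ≤ ½` for `n ≥ 2`**: Stevens' smoothed Dedekind–Eisenstein measure
`Sm_5^5((χ₋₄E₁)ˇ ⋆ χ₋₄E₁) = (χ₋₄E_{1,5})ˇ ⋆ χ₋₄E_{1,5}` takes its values in `2ℤ₂` (both factors are even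
and `ℤ₂`-valued). [cite: Stevens1982, §5.4 Prop. 5.4.1 (PDF p. 73)] [cite: LangCyclotomic1990, Ch. 4 §3 (PDF p. 84, χE_{1,c})] -/
theorem norm_klTwoConv_le_half {n : ℕ} (hn : 2 ≤ n) (a : ZMod (2 ^ n)) : ‖klTwoConv n a‖ ≤ 2⁻¹ := by
  have h := norm_unitsConv_le_half_of_even hn klTwoMeasureInv_neg klTwoMeasure_neg
    norm_klTwoMeasureInv_le_one norm_klTwoMeasure_le_one a
  simpa using h

/-- **`‖Sm_5^5 E_{T,κ}(a + 2ⁿℤ₂)‖ ≤ ½`** for `n ≥ 2` and `2`-integral coefficients `κ_t`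
(`Sm_5^5 E_{T,κ} = ∑_t κ_tχ₋₄(t)[t]^* klTwoConv`). [cite: Stevens1982, §5.4 Prop. 5.4.1 (PDF p. 73)] -/
theorem norm_smoothedEisensteinDedekindTwo_le_half (T : Finset ℕ) (κ : ℕ → ℚ)
    (hκ : ∀ t ∈ T, ‖(κ t : ℚ_[2])‖ ≤ 1) {n : ℕ} (hn : 2 ≤ n) (a : ZMod (2 ^ n)) :
    ‖smoothedEisensteinDedekindTwo T κ n a‖ ≤ 2⁻¹ := by
  simp only [smoothedEisensteinDedekindTwo, Finset.sum_apply, Pi.smul_apply, smul_eq_mul]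
  refine IsUltrametricDist.norm_sum_le_of_forall_le_of_nonneg (by norm_num) fun t ht ↦ ?_
  rw [norm_mul, norm_mul]
  have h1 : ‖((chiMinusFour 2 t : ℤ_[2]) : ℚ_[2])‖ ≤ 1 := PadicInt.norm_le_one _
  have h2 : ‖codilate t klTwoConv n a‖ ≤ 2⁻¹ := by
    rw [codilate_apply]; exact norm_klTwoConv_le_half hn _
  have h0 : ‖(κ t : ℚ_[2])‖ ≤ 1 := hκ t ht
  calc ‖(κ t : ℚ_[2])‖ * ‖((chiMinusFour 2 t : ℤ_[2]) : ℚ_[2])‖ * ‖codilate t klTwoConv n a‖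
      ≤ 1 * 1 * 2⁻¹ := by gcongr
    _ = 2⁻¹ := by ring

end Pairing

/-! ## §2 Mod-`8` rigidity under `Sm_5^5` on the `η = +1` tower -/

section ModEight

/-- `5` is a unit modulo `2^k`. [cite: Washington1997, §7.2 (5 generates 1 + 4ℤ₂)] -/
private theorem isUnit_five (k : ℕ) : IsUnit (5 : ZMod (2 ^ k)) := by
  have h : Nat.Coprime 5 (2 ^ k) := Nat.Coprime.pow_right k (by norm_num)
  have h' := (ZMod.unitOfCoprime 5 h).isUnit
  rwa [ZMod.coe_unitOfCoprime, Nat.cast_ofNat] at h'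

/-- The classes `5^s (mod 2^{m+2})` are `≡ 1 (mod 4)`. [cite: Washington1997, §7.2 (5 generates 1 + 4ℤ₂)] -/
theorem val_pow_five_mod_four (m s : ℕ) : ((5 : ZMod (2 ^ (m + 2))) ^ s).val % 4 = 1 := by
  haveI : NeZero (2 ^ (m + 2)) := ⟨pow_ne_zero _ two_ne_zero⟩
  have h : ((5 : ZMod (2 ^ (m + 2))) ^ s) = ((5 ^ s : ℕ) : ZMod (2 ^ (m + 2))) := by push_cast; rfl
  rw [h, ZMod.val_natCast, Nat.mod_mod_of_dvd _ (show 4 ∣ 2 ^ (m + 2) from ⟨2 ^ m, by ring⟩),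
    Nat.pow_mod]
  norm_num

/-- `5^{2^m} ≡ 1 (mod 2^{m+2})` (the order of `5` modulo `2^{m+2}` is `2^m`).
[cite: Washington1997, §7.2 (5 generates 1 + 4ℤ₂)] -/
theorem pow_five_two_pow_eq_one (m : ℕ) : (5 : ZMod (2 ^ (m + 2))) ^ (2 ^ m) = 1 := by
  have h := pow_orderOf_eq_one (5 : ZMod (2 ^ (m + 2)))
  rwa [ZMod.orderOf_five] at h

/-- `5^{2^m} ≢ 1 (mod 2^{m+3})`. [cite: Washington1997, §7.2 (5 generates 1 + 4ℤ₂)] -/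
theorem pow_five_two_pow_ne_one (m : ℕ) : (5 : ZMod (2 ^ (m + 2 + 1))) ^ (2 ^ m) ≠ 1 := by
  have hord : orderOf (5 : ZMod (2 ^ (m + 2 + 1))) = 2 ^ (m + 1) := by
    have h := ZMod.orderOf_five (m + 1)
    rw [show m + 1 + 2 = m + 2 + 1 by ring] at h
    exact h
  refine pow_ne_one_of_lt_orderOf (pow_ne_zero _ two_ne_zero) ?_
  rw [hord]
  exact Nat.pow_lt_pow_right (by norm_num) (by omega)

/-- **The classes `≡ 1 (mod 4)` of level `2^{m+2}` are exactly the `5^s`, `s < 2^m`**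
(`ℤ₂^× = {±1} × 5^{ℤ₂}`; tree `exists_classMap_eq_of_isUnit` at `p = 2`, where the Teichmüller part
`−1` is excluded by the residue mod `4`). [cite: Washington1997, §7.2 (ℤ₂^× = {±1} × (1 + 4ℤ₂))] -/
theorem exists_pow_five_eq_of_val_mod_four (m : ℕ) (a : ZMod (2 ^ (m + 2))) (ha : a.val % 4 = 1) :
    ∃ s : ℕ, s < 2 ^ m ∧ (5 : ZMod (2 ^ (m + 2))) ^ s = a := by
  haveI : NeZero (2 ^ (m + 2)) := ⟨pow_ne_zero _ two_ne_zero⟩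
  haveI : NeZero (2 ^ m) := ⟨pow_ne_zero _ two_ne_zero⟩
  have hodd : Odd a.val := by rw [Nat.odd_iff]; omega
  have hu : IsUnit a := by
    have hcop : a.val.Coprime (2 ^ (m + 2)) :=
      Nat.Coprime.pow_right _ (Nat.coprime_two_right.mpr hodd)
    have h := (ZMod.isUnit_iff_coprime a.val (2 ^ (m + 2))).mpr hcop
    rwa [ZMod.natCast_zmod_val] at h
  have he : cyclotomicExponent 2 = 2 := rfl
  have hγ : cyclotomicGenerator 2 = 5 := rfl
  have hτ : torsionOrder 2 = 2 := by rw [torsionOrder, he]; decide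
  obtain ⟨η, s, h⟩ := exists_classMap_eq_of_isUnit 2 m (u := a) hu
  have h' : PadicInt.toZModPow (m + 2) ((η : ℤ_[2]ˣ) : ℤ_[2]) * (5 : ZMod (2 ^ (m + 2))) ^ s.val = a := by
    have h5 : ((cyclotomicGenerator 2 : ℕ) : ZMod (2 ^ (m + 2))) = 5 := by rw [hγ, Nat.cast_ofNat]
    rw [← h5]
    exact h
  have hη2 : ((η : ℤ_[2]ˣ) : ℤ_[2]) ^ 2 = 1 := by
    have h2 := rootsOfUnity_pow_torsionOrder 2 η
    exact (congrArg (fun k : ℕ ↦ ((η : ℤ_[2]ˣ) : ℤ_[2]) ^ k) hτ).symm.trans h2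
  rcases sq_eq_one_iff.mp hη2 with h1 | h1
  · rw [h1, map_one, one_mul] at h'
    exact ⟨s.val, ZMod.val_lt s, h'⟩
  · exfalso
    rw [h1, map_neg, map_one, neg_one_mul] at h'
    have hv := val_pow_five_mod_four m s.val
    have hne : (5 : ZMod (2 ^ (m + 2))) ^ s.val ≠ 0 := by
      intro h0; rw [h0, ZMod.val_zero] at hv; omega
    have hneg : a.val = 2 ^ (m + 2) - ((5 : ZMod (2 ^ (m + 2))) ^ s.val).val := by
      have h'' := congrArg ZMod.val h'.symm
      rwa [ZMod.neg_val, if_neg hne] at h''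
    have hlt := ZMod.val_lt ((5 : ZMod (2 ^ (m + 2))) ^ s.val)
    have h4 : 2 ^ (m + 2) = 4 * 2 ^ m := by ring
    omega

/-- **The fibre of `ℤ/2^{n+1} → ℤ/2ⁿ` over `a`** is `{a.val, a.val + 2ⁿ}`. [folklore: structure of ℤ/2^{n+1} → ℤ/2ⁿ]
[cite: Washington1997, §7.2] -/
theorem filter_castHom_eq_pair (n : ℕ) (a : ZMod (2 ^ n)) :
    Finset.univ.filter (fun b : ZMod (2 ^ (n + 1)) ↦
        ZMod.castHom (pow_dvd_pow 2 n.le_succ) (ZMod (2 ^ n)) b = a) =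
      {((a.val : ℕ) : ZMod (2 ^ (n + 1))), ((a.val + 2 ^ n : ℕ) : ZMod (2 ^ (n + 1)))} := by
  haveI : NeZero (2 ^ n) := ⟨pow_ne_zero _ two_ne_zero⟩
  haveI : NeZero (2 ^ (n + 1)) := ⟨pow_ne_zero _ two_ne_zero⟩
  have h2n : 2 ^ (n + 1) = 2 * 2 ^ n := by ring
  have ha : a.val < 2 ^ n := ZMod.val_lt a
  ext b
  simp only [Finset.mem_filter, Finset.mem_univ, true_and, Finset.mem_insert, Finset.mem_singleton]
  have hb : b.val < 2 ^ (n + 1) := ZMod.val_lt b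
  have hcast : ZMod.castHom (pow_dvd_pow 2 n.le_succ) (ZMod (2 ^ n)) b = ((b.val : ℕ) : ZMod (2 ^ n)) := by
    rw [ZMod.castHom_apply, ZMod.cast_eq_val]
  rw [hcast]
  constructor
  · intro h
    have hmod : b.val % 2 ^ n = a.val := by
      have h' := congr_arg ZMod.val h
      rwa [ZMod.val_natCast] at h'
    have hb' : b = ((b.val : ℕ) : ZMod (2 ^ (n + 1))) := (ZMod.natCast_zmod_val b).symm
    rcases Nat.lt_or_ge b.val (2 ^ n) with hlt | hge
    · left
      have hbv : b.val = a.val := by rwa [Nat.mod_eq_of_lt hlt] at hmod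
      rw [hb', hbv]
    · right
      have hsub : b.val % 2 ^ n = b.val - 2 ^ n := by
        rw [Nat.mod_eq_sub_mod hge, Nat.mod_eq_of_lt (by omega)]
      have hbv : b.val = a.val + 2 ^ n := by omega
      rw [hb', hbv]
  · rintro (rfl | rfl)
    · rw [ZMod.val_natCast, Nat.mod_eq_of_lt (by omega), ZMod.natCast_zmod_val]
    · rw [ZMod.val_natCast, Nat.mod_eq_of_lt (by omega), Nat.cast_add, ZMod.natCast_zmod_val,
        ZMod.natCast_self, add_zero]

/-- The two lifts are distinct. [cite: Washington1997, §7.2] -/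
private theorem lift_ne_lift_add (n : ℕ) (a : ZMod (2 ^ n)) :
    ((a.val : ℕ) : ZMod (2 ^ (n + 1))) ≠ ((a.val + 2 ^ n : ℕ) : ZMod (2 ^ (n + 1))) := by
  haveI : NeZero (2 ^ n) := ⟨pow_ne_zero _ two_ne_zero⟩
  haveI : NeZero (2 ^ (n + 1)) := ⟨pow_ne_zero _ two_ne_zero⟩
  have h2n : 2 ^ (n + 1) = 2 * 2 ^ n := by ring
  have ha : a.val < 2 ^ n := ZMod.val_lt a
  intro h
  have h' := congr_arg ZMod.val h
  rw [ZMod.val_natCast, ZMod.val_natCast, Nat.mod_eq_of_lt (by omega), Nat.mod_eq_of_lt (by omega)] at h'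
  have : 0 < 2 ^ n := pow_pos (by norm_num) n
  omega

/-- **Summation over the fibre of `ℤ/2^{n+1} → ℤ/2ⁿ`**: `∑_{b ↦ a} g(b) = g(ã) + g(ã + 2ⁿ)` with `ã` the
canonical lift. [cite: Washington1997, §7.2] -/
theorem sum_filter_castHom_eq_add {A : Type*} [AddCommMonoid A] (n : ℕ) (g : ZMod (2 ^ (n + 1)) → A)
    (a : ZMod (2 ^ n)) :
    ∑ b ∈ Finset.univ.filter (fun b : ZMod (2 ^ (n + 1)) ↦
        ZMod.castHom (pow_dvd_pow 2 n.le_succ) (ZMod (2 ^ n)) b = a), g b =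
      g ((a.val : ℕ) : ZMod (2 ^ (n + 1))) + g ((a.val + 2 ^ n : ℕ) : ZMod (2 ^ (n + 1))) := by
  rw [filter_castHom_eq_pair, Finset.sum_pair (lift_ne_lift_add n a)]

/-- **The two lifts of `5^s (mod 2^{m+2})` to level `2^{m+3}` are `5^s` and `5^{s+2^m}`**:
`∑_{b ↦ 5^s} g(b) = g(5^s) + g(5^{s+2^m})`. [cite: Washington1997, §7.2 (5 generates 1 + 4ℤ₂)] -/
theorem sum_filter_castHom_pow_five {A : Type*} [AddCommMonoid A] (m s : ℕ)
    (g : ZMod (2 ^ (m + 2 + 1)) → A) :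
    ∑ b ∈ Finset.univ.filter (fun b : ZMod (2 ^ (m + 2 + 1)) ↦
        ZMod.castHom (pow_dvd_pow 2 (m + 2).le_succ) (ZMod (2 ^ (m + 2))) b =
          (5 : ZMod (2 ^ (m + 2))) ^ s), g b =
      g ((5 : ZMod (2 ^ (m + 2 + 1))) ^ s) + g ((5 : ZMod (2 ^ (m + 2 + 1))) ^ (s + 2 ^ m)) := by
  have hne : (5 : ZMod (2 ^ (m + 2 + 1))) ^ s ≠ (5 : ZMod (2 ^ (m + 2 + 1))) ^ (s + 2 ^ m) := by
    intro h
    have hu : IsUnit ((5 : ZMod (2 ^ (m + 2 + 1))) ^ s) := (isUnit_five _).pow s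
    have h1 : (5 : ZMod (2 ^ (m + 2 + 1))) ^ s * 1 = (5 : ZMod (2 ^ (m + 2 + 1))) ^ s * 5 ^ (2 ^ m) := by
      rw [mul_one, ← pow_add (5 : ZMod (2 ^ (m + 2 + 1))) s (2 ^ m)]; exact h
    exact pow_five_two_pow_ne_one m ((hu.mul_right_inj.mp h1).symm)
  have hpair : Finset.univ.filter (fun b : ZMod (2 ^ (m + 2 + 1)) ↦
        ZMod.castHom (pow_dvd_pow 2 (m + 2).le_succ) (ZMod (2 ^ (m + 2))) b =
          (5 : ZMod (2 ^ (m + 2))) ^ s) =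
      {(5 : ZMod (2 ^ (m + 2 + 1))) ^ s, (5 : ZMod (2 ^ (m + 2 + 1))) ^ (s + 2 ^ m)} := by
    symm
    apply Finset.eq_of_subset_of_card_le
    · intro b hb
      simp only [Finset.mem_insert, Finset.mem_singleton] at hb
      rw [Finset.mem_filter]
      refine ⟨Finset.mem_univ _, ?_⟩
      rcases hb with rfl | rfl
      · rw [map_pow, map_ofNat]
      · rw [map_pow, map_ofNat, pow_add (5 : ZMod (2 ^ (m + 2))) s (2 ^ m), pow_five_two_pow_eq_one,
          mul_one]
    · rw [filter_castHom_eq_pair, Finset.card_pair (lift_ne_lift_add _ _), Finset.card_pair hne]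
  rw [hpair, Finset.sum_pair hne]

/-- **Mod-`8` rigidity of the `η = +1` tower under Stevens' smoothing `Sm_5^5`.**  Let `f` be a set
function on `ℤ₂` and `m₀ ∈ ℕ` such that on every class `a ≡ 1 (mod 4)` of every level `2^{m+2}`,
`m ≥ m₀`: (i) `‖f(a)‖ ≤ 1`; (ii) `‖(Sm_5^5 f)(a)‖ ≤ ‖8‖`; (iii) the distribution relation holds `mod 8` up
to a level constant `κ_m`: `‖∑_{b ↦ a} f(b) − f(a) − κ_m‖ ≤ ‖8‖`; (iv) `f(1 + 2^{m+2}ℤ₂) = 0`.  Then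
`‖f(a)‖ ≤ ‖8‖` on all these classes.  (On `Γ_m = ⟨5⟩`, (ii) forces `f(5^s) ≡ s·δ_m (mod 8)` — constant second
differences —, (iii) gives `δ_m ≡ 2δ_{m+1}`, so `δ_m ≡ 8δ_{m+3} ≡ 0`.)  This is the value-level
"un-smoothing" modulo `8`: in `ℤ/8[Γ_m]` the operator `(1 − 5[5]_*)(1 − 5[5]^*)` is not injective, and the
tower hypothesis (iii) is what removes its kernel.
[cite: Stevens1982, §5.2 (PDF pp. 68–69, Sm_r) and §5.4 (PDF p. 73, Sm_{r₁}^{r₂})] [cite: Washington1997, §7.2] -/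
theorem norm_le_eighth_of_stevensSmoothing {f : (n : ℕ) → ZMod (2 ^ n) → ℚ_[2]} {m₀ : ℕ}
    (hint : ∀ m, m₀ ≤ m → ∀ a : ZMod (2 ^ (m + 2)), a.val % 4 = 1 → ‖f (m + 2) a‖ ≤ 1)
    (hSm : ∀ m, m₀ ≤ m → ∀ a : ZMod (2 ^ (m + 2)), a.val % 4 = 1 →
      ‖stevensSmoothing 5 f (m + 2) a‖ ≤ 8⁻¹)
    (htower : ∀ m, m₀ ≤ m → ∃ κ : ℚ_[2], ∀ a : ZMod (2 ^ (m + 2)), a.val % 4 = 1 →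
      ‖(∑ b ∈ Finset.univ.filter (fun b : ZMod (2 ^ (m + 2 + 1)) ↦
          ZMod.castHom (pow_dvd_pow 2 (m + 2).le_succ) (ZMod (2 ^ (m + 2))) b = a), f (m + 2 + 1) b) -
        f (m + 2) a - κ‖ ≤ 8⁻¹)
    (hone : ∀ m, m₀ ≤ m → f (m + 2) 1 = 0)
    {m : ℕ} (hm : m₀ ≤ m) (a : ZMod (2 ^ (m + 2))) (ha : a.val % 4 = 1) :
    ‖f (m + 2) a‖ ≤ 8⁻¹ := by
  -- values along `Γ_m = ⟨5⟩`
  set F : ℕ → ℕ → ℚ_[2] := fun m s ↦ f (m + 2) ((5 : ZMod (2 ^ (m + 2))) ^ s) with hF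
  have hF0 : ∀ m, m₀ ≤ m → F m 0 = 0 := fun m hm ↦ by simp only [hF, pow_zero]; exact hone m hm
  have hFint : ∀ m, m₀ ≤ m → ∀ s, ‖F m s‖ ≤ 1 := fun m hm s ↦ hint m hm _ (val_pow_five_mod_four m s)
  have h8 : (0 : ℝ) < 8⁻¹ := by norm_num
  -- Step 1: constant second differences mod 8
  have h2nd : ∀ m, m₀ ≤ m → ∀ s, ‖F m (s + 2) - 2 * F m (s + 1) + F m s‖ ≤ 8⁻¹ := by
    intro m hm s
    have hS := hSm m hm _ (val_pow_five_mod_four m (s + 1))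
    have e1 : (5 : ZMod (2 ^ (m + 2))) ^ (s + 1) * ((5 : ℕ) : ZMod (2 ^ (m + 2)))⁻¹ =
        (5 : ZMod (2 ^ (m + 2))) ^ s := by
      rw [Nat.cast_ofNat, pow_succ (5 : ZMod (2 ^ (m + 2))) s, mul_assoc,
        ZMod.mul_inv_of_unit _ (isUnit_five _), mul_one]
    have e2 : (5 : ZMod (2 ^ (m + 2))) ^ (s + 1) * ((5 : ℕ) : ZMod (2 ^ (m + 2))) =
        (5 : ZMod (2 ^ (m + 2))) ^ (s + 2) := by
      rw [Nat.cast_ofNat, ← pow_succ (5 : ZMod (2 ^ (m + 2))) (s + 1)]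
    have hval : stevensSmoothing 5 f (m + 2) ((5 : ZMod (2 ^ (m + 2))) ^ (s + 1)) =
        F m (s + 1) - 5 * F m s - 5 * F m (s + 2) + 25 * F m (s + 1) := by
      simp only [stevensSmoothing, Pi.add_apply, Pi.sub_apply, Pi.smul_apply, smul_eq_mul,
        dilate_apply, codilate_apply, e1, e2, hF]
      push_cast
      ring
    rw [hval] at hS
    have hid : (5 : ℚ_[2]) * (F m (s + 2) - 2 * F m (s + 1) + F m s) =
        -(F m (s + 1) - 5 * F m s - 5 * F m (s + 2) + 25 * F m (s + 1)) + 16 * F m (s + 1) := by ring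
    have h16 : ‖(16 : ℚ_[2]) * F m (s + 1)‖ ≤ 8⁻¹ := by
      rw [norm_mul, norm_sixteen']
      calc (16 : ℝ)⁻¹ * ‖F m (s + 1)‖ ≤ 16⁻¹ * 1 := by gcongr; exact hFint m hm _
        _ ≤ 8⁻¹ := by norm_num
    have h5 : ‖(5 : ℚ_[2]) * (F m (s + 2) - 2 * F m (s + 1) + F m s)‖ ≤ 8⁻¹ := by
      rw [hid]
      refine (norm_add_le_max' _ _).trans (max_le ?_ h16)
      rw [norm_neg]; exact hS
    rwa [norm_mul, norm_five', one_mul] at h5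
  -- Step 2: arithmetic progression `F m s ≡ s·δ_m`, `δ_m = F m 1`
  have hlin : ∀ m, m₀ ≤ m → ∀ s, ‖F m s - (s : ℚ_[2]) * F m 1‖ ≤ 8⁻¹ := by
    intro m hm
    have key : ∀ s, ‖F m s - (s : ℚ_[2]) * F m 1‖ ≤ 8⁻¹ ∧
        ‖F m (s + 1) - ((s + 1 : ℕ) : ℚ_[2]) * F m 1‖ ≤ 8⁻¹ := by
      intro s
      induction s with
      | zero =>
        refine ⟨?_, ?_⟩
        · rw [hF0 m hm]; simp
        · simp
      | succ s ih =>
        refine ⟨ih.2, ?_⟩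
        have hid : F m (s + 1 + 1) - ((s + 1 + 1 : ℕ) : ℚ_[2]) * F m 1 =
            (F m (s + 2) - 2 * F m (s + 1) + F m s) +
              2 * (F m (s + 1) - ((s + 1 : ℕ) : ℚ_[2]) * F m 1) - (F m s - (s : ℚ_[2]) * F m 1) := by
          push_cast; ring
        rw [hid]
        refine (norm_sub_le_max' _ _).trans (max_le ((norm_add_le_max' _ _).trans (max_le
          (h2nd m hm s) ?_)) ih.1)
        rw [norm_mul, norm_two']
        calc (2 : ℝ)⁻¹ * ‖F m (s + 1) - ((s + 1 : ℕ) : ℚ_[2]) * F m 1‖ ≤ 2⁻¹ * 8⁻¹ := by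
              gcongr; exact ih.2
          _ ≤ 8⁻¹ := by norm_num
    exact fun s ↦ (key s).1
  -- Step 3: the tower relation `δ_m ≡ 2 δ_{m+1}`
  have hF' : ∀ m s, F (m + 1) s = f (m + 2 + 1) ((5 : ZMod (2 ^ (m + 2 + 1))) ^ s) := fun m s ↦ rfl
  have htow : ∀ m, m₀ ≤ m → ‖F m 1 - 2 * F (m + 1) 1‖ ≤ 8⁻¹ := by
    intro m hm
    have hm' : m₀ ≤ m + 1 := Nat.le_succ_of_le hm
    obtain ⟨κ, hκ⟩ := htower m hm
    have hX := hκ ((5 : ZMod (2 ^ (m + 2))) ^ 1) (val_pow_five_mod_four m 1)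
    have hY := hκ ((5 : ZMod (2 ^ (m + 2))) ^ 0) (val_pow_five_mod_four m 0)
    rw [sum_filter_castHom_pow_five m 1 (f (m + 2 + 1))] at hX
    rw [sum_filter_castHom_pow_five m 0 (f (m + 2 + 1))] at hY
    rw [← hF', ← hF'] at hX hY
    change ‖F (m + 1) 1 + F (m + 1) (1 + 2 ^ m) - F m 1 - κ‖ ≤ 8⁻¹ at hX
    change ‖F (m + 1) 0 + F (m + 1) (0 + 2 ^ m) - F m 0 - κ‖ ≤ 8⁻¹ at hY
    rw [zero_add, hF0 m hm, hF0 (m + 1) hm', zero_add, sub_zero] at hY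
    have hA := hlin (m + 1) hm' 1
    have hB := hlin (m + 1) hm' (1 + 2 ^ m)
    have hC := hlin (m + 1) hm' (2 ^ m)
    have hid : F m 1 - 2 * F (m + 1) 1 =
        (F (m + 1) 1 - ((1 : ℕ) : ℚ_[2]) * F (m + 1) 1) +
          (F (m + 1) (1 + 2 ^ m) - ((1 + 2 ^ m : ℕ) : ℚ_[2]) * F (m + 1) 1) -
          (F (m + 1) (2 ^ m) - ((2 ^ m : ℕ) : ℚ_[2]) * F (m + 1) 1) -
          (F (m + 1) 1 + F (m + 1) (1 + 2 ^ m) - F m 1 - κ) +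
          (F (m + 1) (2 ^ m) - κ) := by
      push_cast; ring
    rw [hid]
    refine (norm_add_le_max' _ _).trans (max_le ((norm_sub_le_max' _ _).trans (max_le
      ((norm_sub_le_max' _ _).trans (max_le ((norm_add_le_max' _ _).trans (max_le hA hB)) hC)) hX)) hY)
  -- Step 4: `δ_m ≡ 0 (mod 8)`
  have hδ : ∀ m, m₀ ≤ m → ‖F m 1‖ ≤ 8⁻¹ := by
    intro m hm
    have h1 := htow m hm
    have h2 := htow (m + 1) (by omega)
    have h3 := htow (m + 2) (by omega)
    have h4 : ‖F (m + 3) 1‖ ≤ 1 := hFint (m + 3) (by omega) 1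
    have hid : F m 1 = (F m 1 - 2 * F (m + 1) 1) + 2 * (F (m + 1) 1 - 2 * F (m + 1 + 1) 1) +
        4 * (F (m + 2) 1 - 2 * F (m + 2 + 1) 1) + 8 * F (m + 3) 1 := by ring
    have h2le : ‖(2 : ℚ_[2])‖ ≤ 1 := by simpa using norm_natCast_le_one' 2
    have h4le : ‖(4 : ℚ_[2])‖ ≤ 1 := by simpa using norm_natCast_le_one' 4
    have n2 : ‖(2 : ℚ_[2]) * (F (m + 1) 1 - 2 * F (m + 1 + 1) 1)‖ ≤ 8⁻¹ := by
      rw [norm_mul]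
      calc ‖(2 : ℚ_[2])‖ * ‖F (m + 1) 1 - 2 * F (m + 1 + 1) 1‖ ≤ 1 * 8⁻¹ :=
            mul_le_mul h2le h2 (norm_nonneg _) zero_le_one
        _ = 8⁻¹ := one_mul _
    have n4 : ‖(4 : ℚ_[2]) * (F (m + 2) 1 - 2 * F (m + 2 + 1) 1)‖ ≤ 8⁻¹ := by
      rw [norm_mul]
      calc ‖(4 : ℚ_[2])‖ * ‖F (m + 2) 1 - 2 * F (m + 2 + 1) 1‖ ≤ 1 * 8⁻¹ :=
            mul_le_mul h4le h3 (norm_nonneg _) zero_le_one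
        _ = 8⁻¹ := one_mul _
    have n8 : ‖(8 : ℚ_[2]) * F (m + 3) 1‖ ≤ 8⁻¹ := by
      rw [norm_mul, norm_eight']
      calc (8 : ℝ)⁻¹ * ‖F (m + 3) 1‖ ≤ 8⁻¹ * 1 := by gcongr
        _ = 8⁻¹ := mul_one _
    rw [hid]
    exact (norm_add_le_max' _ _).trans (max_le ((norm_add_le_max' _ _).trans (max_le
      ((norm_add_le_max' _ _).trans (max_le h1 n2)) n4)) n8)
  -- Step 5: conclude at `a = 5^s`
  obtain ⟨s, -, rfl⟩ := exists_pow_five_eq_of_val_mod_four m a ha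
  have hs := hlin m hm s
  have hid : f (m + 2) ((5 : ZMod (2 ^ (m + 2))) ^ s) =
      (F m s - (s : ℚ_[2]) * F m 1) + (s : ℚ_[2]) * F m 1 := by simp only [hF]; ring
  rw [hid]
  refine (norm_add_le_max' _ _).trans (max_le hs ?_)
  rw [norm_mul]
  calc ‖(s : ℚ_[2])‖ * ‖F m 1‖ ≤ 1 * 8⁻¹ := by gcongr; exact norm_natCast_le_one' s; exact hδ m hm
    _ = 8⁻¹ := one_mul _

end ModEight


end Literature.NumberTheory.EllipticCurves

end
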